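import Summits.QuantumFields.YangMills.Theorems.BalabanUVNodesN12AtRecord13SepCoPHSockets

/-!
# BalabanUVNodes ∕ N12 — THE K1⁷ v5 RUNG BODY AT THE ABSTRACT INHABITANT: for ANY v1.7 parameter `θ` carrying EXACTLY the K1⁷ antecedent `Inhabited13 F`'s data, the registered rung shape is
# witnessed by `θ` ITSELF at the S-bound generic-`W₀` four-pin world, N12 resolved below the torus at `θ`'s OWN selector from the CORE-level displays (the literal reading of
# `stub_nodes13PWS : Inhabited13 F → NodesAtSomeRecord13PWS F`) (Track A, DAG node N12 = [B15, Balaban1989LargeFieldI] CMP **122** (1989) 175–202; cluster K1 — K1⁷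
# `StabilityBAtRecordR13SepCoPH` = stmt-QuantumFields-20542, helper; seat `pub-ymgap-dag-n12-d` g13 (R134 s2 «knit at the record»), 2026-08-27; count-neutral, NOT a discharge)

HONEST FRAMING.  Count-neutral kernel COMPOSITION BY NAME: 12T-H `…N12AtRecord13SepCoPHSockets` §0 (this seat's S-bound generic-`W₀` four-pin engine at a GENERIC `θ : Stage13HParams` —
`nodes₁₃CoPH_upS_fourPinW₀_pointed`, `recordS₁₃SepCoPH_of_upS_pinB10YZW₀`) with N12's `h12` slot fed BY THE MIXED W-PIN through §1 = 12A's `b15Leaf_WOfRecord₁₃_of_provisosInt_massSel` at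
`θ.toStage13Params`, whose (0.3) provisos come from the H-LEVEL CORE row `Provisos₁₃CoPH.rstep` (node00-def-T FILE 27; the v1.2 θ-level `Provisos₁₃Core` of 12G §1 is not derivable from an
H-package — its `Zt` rows were replaced).  WHY: the registered K1⁷ stub reads `Inhabited13 F → NodesAtSomeRecord13PWS F`; every socket of this seat so far is keyed either at a LIVE RE-PIN with
K0b's residuals of record (`hres`; 12T-H §1–§2) or at a concrete K0 witness (12Y ∕ 12Z); at an ABSTRACT inhabitant neither is available, so here is what the rung costs THERE: N12 below the torus at
`θ`'s own pre-selected classes — the (1.100) pin equation, the selected masses `h12massSel` (positive mass of EVERY selected term — NOT live-mass), the fibre witness `h12fib` (free only at an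
idempotent selector, unknown for an abstract `θ`), Proposition 1 (1.78), (1.80), (1.89) —; N13's (R₁₃CoPH) row `hR` DISPLAYED (dag-n11-e's construction `laws₁₃CoPH_liveRepin₁₃_of_hasResiduals` needs
the live selector); the other rows as in 12T-H.  The two readings of the stub are thus both served: literal (this file; heavier per-run N12 ∕ N13 displays) and at the K0⁷ witness of record
(12Y §4 ∕ 12Z §1; live-mass, N13 a theorem, K0-side = V14 stub 3's letters).  Nothing of Bałaban's is asserted; N12 is NOT discharged; no node is discharged; counts unmoved (discharged 5∕27 ·
Track A 5∕28).  ONE finite four-torus programme at fixed `ε = L^{-K}` — nothing continuum ∕ ℝ⁴ ∕ OS ∕ mass gap ∕ Clay.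
-/

noncomputable section
open MeasureTheory
open scoped Matrix.Norms.L2Operator
namespace Summit.QuantumFields.YangMills.BalabanUVNodes.N12AtRecord13SepCoPHAtInhabitant
open Literature.MathematicalPhysics.QuantumFieldTheory.Balaban1983to89
open Literature.MathematicalPhysics.QuantumFieldTheory.Balaban1983to89.T4Continuum (T4Family)
open Literature.MathematicalPhysics.QuantumFieldTheory.Balaban1983to89.DagBinding
open Literature.MathematicalPhysics.QuantumFieldTheory.Balaban1983to89.Node00
open FlowStep (BetaLowerH BetaUpperH)
open FlowStepRuns (genFlow)
open B15Claim189Assembly (new189 chiPP dom)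
open B15 (Prop1Printed Ineq180)
open B15.BasicStep (Claim189)
open B8Eq17ClassAkV1 (plaqsOf)
open B15RPrime1100OfRep (rPrimeDataOfSel)
open Summit.QuantumFields.YangMills.BalabanUVNodes.N12LeafIntAtRecord13 (b15Leaf_WOfRecord₁₃_of_provisosInt_massSel)
open Summit.QuantumFields.YangMills.BalabanUVNodes.N12AtRecord13SepCoPHSockets (nodes₁₃CoPH_upS_fourPinW₀_pointed recordS₁₃SepCoPH_of_upS_pinB10YZW₀)

variable {N : ℕ} [NeZero N] {F : T4Family}

/-! ## §1 N12's row AT A GENERIC v1.7 PARAMETER from the CORE provisos `Provisos₁₃CoPH` (the H-level core; v1.2's θ-level `Provisos₁₃Core` is NOT derivable from it — its `Zt` rows are gone) -/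

section CoreRow
variable (θ : Stage13HParams F N) (lam : ResidW F N)

/-- **def-R's (0.3) provisos (integrable form) of the knit datum at the ₁₃ pre-𝐑 representation of record, FROM THE H-LEVEL CORE row `rstep`** (`k < K`; 12A's ∕ 12G's bridge verbatim at
`θ.toStage13Params`: `toRepData_towerRepOfRecord_eq`). [cite: Balaban1989LargeFieldI, (0.3)–(0.4) p.176; Balaban1988Convergent, (2.18) p.257, (3.25) p.270 (bookkeeping)] -/
theorem provisosInt_reprTOfRecord₁₃_of_provisos₁₃CoPH (hc : θ.Provisos₁₃CoPH F N) (P : B12.RunParams) (k : ℕ) [DecidableEq (PBond (F.P P.K) (k + 1))] (hk : k < P.K) :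
    (repDataOfSel (reprTOfRecord₁₃ F N θ.toStage13Params P k) (θ.ppSel P (gOfRecord₁₃ F N θ.toStage13Params P) (k + 1))
      (fibOfSeq F θ.ν θ.τ9 P (gOfRecord₁₃ F N θ.toStage13Params P) (k + 1))).ProvisosInt := by
  have h := hc.rstep P k hk
  rw [toRepData_towerRepOfRecord_eq] at h
  exact h

/-- **★ THE [IV] LEAF AT THE STAGE-13 BUNDLE OF RECORD OF A GENERIC v1.7 PARAMETER FROM ITS CORE PROVISOS** (`kSel P < P.K`; 12A's `b15Leaf_WOfRecord₁₃_of_provisosInt_massSel` fed by §1's bridge):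
displayed — the (1.100) pin equation, the selected masses AT `θ`'s OWN selector, the fibre witness, Proposition 1 (1.78), (1.80), (1.89).  The CoPH-keyed twin of 12G §1's `…_of_massSel_core`.
[cite: Balaban1989LargeFieldI, (0.2)–(0.6) p.176, p.176 ll.14–16, Prop. 1 (1.78) p.194, (1.80) p.195, (1.89) p.198, (1.99)–(1.102) pp.200–201; Balaban1988Convergent, (3.25) p.270 (bookkeeping)] -/
theorem b15Leaf_WOfRecord₁₃_of_massSel_coPH (hc : θ.Provisos₁₃CoPH F N) {P : B12.RunParams} (hk : lam.kSel P < P.K)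
    (hpin : lam.D1100 P
      = rPrimeDataOfSel (reprTOfRecord₁₃ F N θ.toStage13Params P (lam.kSel P)) (θ.ppSel P (gOfRecord₁₃ F N θ.toStage13Params P) (lam.kSel P + 1))
          (fibOfSeq F θ.ν θ.τ9 P (gOfRecord₁₃ F N θ.toStage13Params P) (lam.kSel P + 1)))
    (hmassSel : ∀ s, 0 < ∫ V, rterm (reprTOfRecord₁₃ F N θ.toStage13Params P (lam.kSel P)) (θ.ppSel P (gOfRecord₁₃ F N θ.toStage13Params P) (lam.kSel P + 1) s) V
      ∂(fieldMeasure (F.P P.K) (lam.kSel P + 1) (SU N)))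
    (hfib : ∀ s, ∃ s', θ.ppSel P (gOfRecord₁₃ F N θ.toStage13Params P) (lam.kSel P + 1) s' = θ.ppSel P (gOfRecord₁₃ F N θ.toStage13Params P) (lam.kSel P + 1) s ∧
      0 < ∫ V, rterm (reprTOfRecord₁₃ F N θ.toStage13Params P (lam.kSel P)) s' V ∂(fieldMeasure (F.P P.K) (lam.kSel P + 1) (SU N)))
    (hP1 : Prop1Printed (lam.LF P))
    (h180 : ∀ U, new189 (lam.D189 P) U → ∀ i, (lam.D189 P).h ≤ i → i ≤ (lam.D189 P).k → ∀ q ∈ plaqsOf (dom (lam.D189 P) i),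
      Ineq180 ((lam.D189 P).dev0 U q) ((lam.D189 P).ε (lam.D189 P).k) (lam.D189 P).η (lam.D189 P).B₃ (lam.D189 P).B₅ (lam.D189 P).M (lam.D189 P).δ
        ((lam.D189 P).dist q) (lam.D189 P).O1)
    (h189 : Claim189 (new189 (lam.D189 P)) (chiPP (lam.D189 P))) : B15Leaf (WOfRecord₁₃ F N θ.toStage13Params lam P) :=
  b15Leaf_WOfRecord₁₃_of_provisosInt_massSel θ.toStage13Params lam (provisosInt_reprTOfRecord₁₃_of_provisos₁₃CoPH θ hc P (lam.kSel P) hk) hpin hmassSel hfib hP1 h180 h189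

end CoreRow

/-! ## §2 ★★ THE v5 RUNG BODY AT THE INHABITANT ITSELF (12T-H §0's S-bound generic-`W₀` four-pin engine; N12 by the mixed W-pin through §1; N13 displayed) -/

section AtInhabitant
variable (θ : Stage13HParams F N) (lamW : ResidW F N)
  (Mstar : ℕ) (ops : OpsY N θ.toStage3Params Mstar) (ζ : ResidZ F N) (W₀ : B12.RunParams → PrintedCarriers15) (w : WorldP)

/-- **★★ THE K1⁷ v5 RUNG BODY AT THE ABSTRACT INHABITANT ITSELF** — for ANY `θ : Stage13HParams F N` carrying EXACTLY the data of the K1⁷ antecedent `Inhabited13 F` (`Provisos₁₃SepCoPH`, `ZhUnity ∧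
SlotsNondegenerate₁₃`, `Admissible`), the registered rung body `NodesAtSomeRecord13PWS`-shape is witnessed BY `(θ, hP, w)` ITSELF at the S-bound generic-`W₀` four-pin world of `θ` (12T-H §0's engine + `RecordS` literal),
with N12 RESOLVED BELOW THE TORUS AT `θ`'s OWN SELECTOR `θ.ppSel` from the Core-level displays — the (1.100) pin equation, the selected masses `h12massSel`, the fibre witness `h12fib`, Proposition 1, (1.80), (1.89)
(§1, `hP.toCore.rstep`; no residuals of record, no live re-pin: at an abstract inhabitant K0b's `HasResidualsOfRecord` is not available, so live-mass does not translate and the fibre witness is not free) — and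
N13's (R₁₃CoPH) row `hR` DISPLAYED (dag-n11-e's construction needs the live selector).  THIS IS THE LITERAL READING OF `stub_nodes13PWS : Inhabited13 F → NodesAtSomeRecord13PWS F`: a closer may
`rintro F ⟨θ, hP, hU, hθ⟩` and apply this socket at `N := 2`, owing the displayed rows AT `θ`; the alternative reading (ignore the inhabitant, work at the K0⁷ witness of record `θ₁₅ᶜᶜᴹ(jM)` where
N12's live-mass ∕ N13 are resolved further) is 12Y §4 ∕ 12Z §1.  WHICH CHILD BLOCKS (nothing hidden): world binding `hC hγ hL hup`; `h05S`, h06–h11, `hR`, `hUV`; the mixed pin `hW ∕ hWdeg` + `hsel`; N12's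
per-run displays below the torus at `θ.ppSel`.  COMPOSITE: nothing discharged as a node; count-neutral. [cite: Balaban1989LargeFieldII, Thm 1 p.355, (0.1) pp.355–356, p.387, p.391; Balaban1989LargeFieldI, (0.1) p.175, (0.2)–(0.6) p.176, p.176 ll.14–16, p.177 (i)–(ii), Prop. 1 (1.78) p.194, (1.80) p.195, (1.89) p.198, (1.99)–(1.102) pp.200–201; Balaban1988Convergent, (1.11) p.248, p.244, Thm 1 p.262, (2.18) p.257, (3.16)–(3.25) pp.268–270; Balaban1985RegularSpaces, Lemma 1 – Thm 8 pp.79–101, Thm 8 (1.146) p.101 (surviving form); Balaban1985UV3, Thm 1 p.257, Thm 2 p.272; Balaban1985BackgroundPropagators, Thm 3.1 p.397; Balaban1985Variational, Thm 1 p.279; Balaban1987RG1, Thm 1 p.259, Lemma 4 p.280; Balaban1988RG2Cluster, Lemmas 1–3 pp.9–20 (bookkeeping)] -/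
theorem nodesAtSomeRecordS₁₃SepCoPH_of_upS_fourPinW₀_atInhabitant_of_massSel
    -- EXACTLY the data of the K1⁷ antecedent `Inhabited13 F` (plan g73 v5): an H-parameter with the separated-range provisos, the unity ∧ guard pair, admissibility
    (hP : θ.Provisos₁₃SepCoPH F N) (hU : θ.ZhUnity F N ∧ θ.SlotsNondegenerate₁₃ F N) (hθ : θ.Admissible F N)
    -- the mixed W-pin: the generic [IV] carrier family AGREES WITH THE BUNDLE OF RECORD on the runs whose selected step is a printed step, and carries the leaf elsewhere
    (hW : ∀ P : B12.RunParams, lamW.kSel P < P.K → W₀ P = WOfRecord₁₃ F N θ.toStage13Params lamW P) (hWdeg : ∀ P : B12.RunParams, P.K ≤ lamW.kSel P → B15Leaf (W₀ P))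
    (hC : w.C = (datumOfRecord₁₃SepCoPH F N θ hP).C) (hγ : 0 < w.γ ∧ w.γ ≤ θ.toStage13Params.γ) (hL : w.L = (θ.toStage13Params.L : ℝ))
    (hup : ∀ P, w.up P = upOfRecord₅CS F N (((((θ.toStage5₁₃CoPH F N).pinB10 F N).pinY F N (Y9OfRecord N θ.toStage13Params.toStage3Params Mstar ops)).pinZ F N (Z11OfRecord F N ζ)).pinW F N W₀) P)
    (h05S : ∀ P : B12.RunParams, (upOfRecord₅CS F N (((((θ.toStage5₁₃CoPH F N).pinB10 F N).pinY F N (Y9OfRecord N θ.toStage13Params.toStage3Params Mstar ops)).pinZ F N (Z11OfRecord F N ζ)).pinW F N W₀) P).b8)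
    (h06 : B9LeafX (Y9OfRecord N θ.toStage13Params.toStage3Params Mstar ops))
    (h07 : B11Leaf (Z11OfRecord F N ζ))
    (h08 : PrintedUV3V N θ.toStage13Params.L)
    (h09 : ∀ P : B12.RunParams, B12Sec2to5.Lemma4Printed (θ.toStage13Params.res.X P).F12 (θ.toStage13Params.res.X P).c12)
    (h09T : ∀ P : B12.RunParams, (leavesP w P).smallCouplings → (leavesP w P).smallFieldInductive)
    (h10 : ∀ P : B12.RunParams, B9LeafX (Y9OfRecord N θ.toStage13Params.toStage3Params Mstar ops) →
      (B10.Thm1PrintedCompact ((((((θ.toStage5₁₃CoPH F N).pinB10 F N).pinY F N (Y9OfRecord N θ.toStage13Params.toStage3Params Mstar ops)).pinZ F N (Z11OfRecord F N ζ)).pinW F N W₀).res.X P).runs10 ∧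
          B10.Thm2Printed ((((((θ.toStage5₁₃CoPH F N).pinB10 F N).pinY F N (Y9OfRecord N θ.toStage13Params.toStage3Params Mstar ops)).pinZ F N (Z11OfRecord F N ζ)).pinW F N W₀).res.X P).runs10) →
        B11Leaf (Z11OfRecord F N ζ) → B12Sec2to5.Lemma4Printed (θ.toStage13Params.res.X P).F12 (θ.toStage13Params.res.X P).c12 →
          B13.Lemma1Printed (θ.toStage13Params.res.X P).S13 (θ.toStage13Params.res.X P).c13 ∧ B13.Lemma2Printed (θ.toStage13Params.res.X P).S13 (θ.toStage13Params.res.X P).c13 ∧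
            B13.Lemma3Printed (θ.toStage13Params.res.X P).S13 (θ.toStage13Params.res.X P).c13)
    (h11 : ∀ P : B12.RunParams, (leavesP w P).b7 → (leavesP w P).b8 → (leavesP w P).b9 → (leavesP w P).b10 → (leavesP w P).b11 →
      (leavesP w P).smallCouplings → (leavesP w P).smallFieldInductive → (leavesP w P).flowControl →
        ∀ k, k < P.K → SLaw₁₃CoPH F N θ P k → TLaw₁₃CoPH F N θ P k)
    (hR : ∀ (P : B12.RunParams) (k : ℕ), k < P.K → TLaw₁₃CoPH F N θ P k → SLaw₁₃CoPH F N θ P (k + 1))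
    (hUV : ∀ P : B12.RunParams, (genFlow (betaOfRecord₁₃ F N θ.toStage13Params) P.g0).InInterval w.γ P.K → ∀ k, k ≤ P.K → SLaw₁₃CoPH F N θ P k →
      ∀ U : GaugeField (F.P P.K) k (SU N),
        chiβOfRecord₁₃ F N θ.toStage13Params P.K (gOfRecord₁₃ F N θ.toStage13Params P) k U *
              Real.exp (-(1 / (gOfRecord₁₃ F N θ.toStage13Params P k) ^ 2 * wilsonBGOfRecord F N θ.toStage13Params.εbg P k U)
                - w.em (gOfRecord₁₃ F N θ.toStage13Params P k) * (Fintype.card (Site (F.P P.K) k) : ℝ)) ≤ densOfRecord₁₃ F N θ.toStage13Params P k U ∧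
        densOfRecord₁₃ F N θ.toStage13Params P k U ≤ Real.exp (w.ep (gOfRecord₁₃ F N θ.toStage13Params P k) * (Fintype.card (Site (F.P P.K) k) : ℝ)))
    -- N12's displays, run by run, BELOW THE TORUS ONLY
    (h12pin : ∀ P : B12.RunParams, lamW.kSel P < P.K → lamW.D1100 P
      = rPrimeDataOfSel (reprTOfRecord₁₃ F N θ.toStage13Params P (lamW.kSel P))
          (θ.toStage13Params.ppSel P (gOfRecord₁₃ F N θ.toStage13Params P) (lamW.kSel P + 1))
          (fibOfSeq F θ.toStage13Params.ν θ.toStage13Params.τ9 P (gOfRecord₁₃ F N θ.toStage13Params P) (lamW.kSel P + 1)))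
    (h12massSel : ∀ P : B12.RunParams, lamW.kSel P < P.K → ∀ s, 0 < ∫ V, rterm (reprTOfRecord₁₃ F N θ.toStage13Params P (lamW.kSel P))
        (θ.ppSel P (gOfRecord₁₃ F N θ.toStage13Params P) (lamW.kSel P + 1) s) V ∂(fieldMeasure (F.P P.K) (lamW.kSel P + 1) (SU N)))
    (h12fib : ∀ P : B12.RunParams, lamW.kSel P < P.K → ∀ s, ∃ s', θ.ppSel P (gOfRecord₁₃ F N θ.toStage13Params P) (lamW.kSel P + 1) s' = θ.ppSel P (gOfRecord₁₃ F N θ.toStage13Params P) (lamW.kSel P + 1) s ∧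
      0 < ∫ V, rterm (reprTOfRecord₁₃ F N θ.toStage13Params P (lamW.kSel P)) s' V ∂(fieldMeasure (F.P P.K) (lamW.kSel P + 1) (SU N)))
    (h12P1 : ∀ P : B12.RunParams, lamW.kSel P < P.K → Prop1Printed (lamW.LF P))
    (h12i180 : ∀ P : B12.RunParams, lamW.kSel P < P.K → ∀ U, new189 (lamW.D189 P) U → ∀ i, (lamW.D189 P).h ≤ i → i ≤ (lamW.D189 P).k →
      ∀ q ∈ plaqsOf (dom (lamW.D189 P) i),
        Ineq180 ((lamW.D189 P).dev0 U q) ((lamW.D189 P).ε (lamW.D189 P).k) (lamW.D189 P).η (lamW.D189 P).B₃ (lamW.D189 P).B₅ (lamW.D189 P).M (lamW.D189 P).δ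
          ((lamW.D189 P).dist q) (lamW.D189 P).O1)
    (h12c189 : ∀ P : B12.RunParams, lamW.kSel P < P.K → Claim189 (new189 (lamW.D189 P)) (chiPP (lamW.D189 P)))
    (hsel : ∀ P : B12.RunParams, 1 ≤ P.K → lamW.kSel P < P.K) :
    ∃ (θ' : Stage13HParams F N) (h' : θ'.Provisos₁₃SepCoPH F N) (w : WorldP), (θ'.ZhUnity F N ∧ θ'.SlotsNondegenerate₁₃ F N) ∧ θ'.Admissible F N ∧
      (∃ (θ'' : Stage13HParams F N) (h'' : θ''.Provisos₁₃SepCoPH F N), θ''.Admissible F N ∧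
        datumOfRecord₁₃SepCoPH F N θ' h' = datumOfRecord₁₃SepCoPH F N θ'' h'' ∧ w.C = (datumOfRecord₁₃SepCoPH F N θ' h').C ∧ (0 < w.γ ∧ w.γ ≤ θ''.γ) ∧
        w.L = (θ''.L : ℝ) ∧ ∀ P : B12.RunParams, w.up P = upOfRecord₅CS F N (θ''.toStage5₁₃CoPH F N) P) ∧
      (∀ P : B12.RunParams, Nodes (leavesP w P)) ∧ PrintedUV3V N θ'.L ∧
      ∃ lam : ResidW F N, (∀ P : B12.RunParams, 1 ≤ P.K → lam.kSel P < P.K) ∧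
        ∀ P : B12.RunParams, lam.kSel P < P.K → ((leavesP w P).rBasicStep ↔ B15Leaf (WOfRecord₁₃ F N θ'.toStage13Params lam P)) := by
  have hn := nodes₁₃CoPH_upS_fourPinW₀_pointed θ Mstar ops ζ W₀ w hP.toCore hθ hC hγ hL hup h05S h06 h07 h08 h09 h09T h10 h11
    (fun P => by
      by_cases hk : lamW.kSel P < P.K
      · rw [hW P hk]
        exact b15Leaf_WOfRecord₁₃_of_massSel_coPH θ lamW hP.toCore hk (h12pin P hk) (h12massSel P hk) (h12fib P hk) (h12P1 P hk) (h12i180 P hk) (h12c189 P hk)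
      · exact hWdeg P (not_lt.1 hk))
    hR hUV
  exact ⟨θ, hP, w, hU, hθ, recordS₁₃SepCoPH_of_upS_pinB10YZW₀ θ Mstar ops ζ W₀ w hP hθ hC hγ hL hup, hn, h08, lamW, hsel, fun P hk => by
      rw [← hW P hk]
      show (w.up P).rBasicStep ↔ _
      rw [hup P]
      exact Iff.rfl⟩

end AtInhabitant

end Summit.QuantumFields.YangMills.BalabanUVNodes.N12AtRecord13SepCoPHAtInhabitant
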